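import Summits.HubbardSuperconductivity.HubbardSuperconductivity.Theorems.AnisotropyChordTransferFibre3C0Shell
import Summits.HubbardSuperconductivity.HubbardSuperconductivity.Theorems.AnisotropyChordTransferFibre3GradSNormClosed
import Summits.HubbardSuperconductivity.HubbardSuperconductivity.Theorems.AnisotropyChordTransferFibre3KT2bRow

/-!
# Route `AnisotropyChord` / H0 rotor rung: PartN41-C §4 — the SYMMETRIES of the `K = 0` cross term `C0` (`C0PermInvariant` PROVED)

Theory-1 g22's PartN41-C §4 (port …Fibre3KT2bRow): the cross term `C0 = 1_{Dᶜ}((H⁰ − ΔW) − 3λ₂)Π⁰` of an EVEN profile `f` is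
* invariant under the two transpositions generating `S₃` (relabelling of the three particles):
  ★ `C0fn_swap : C0(b,a) = C0(a,b)`, ★ `C0fn_U12 : C0(−a, b−a) = C0(a,b)` — hence ★ `c0PermInvariant_holds (Δ) : C0PermInvariant L Δ`;
* invariant under the lattice inversion ★ `C0fn_neg : C0(−a,−b) = C0(a,b)`, and, for a swap-symmetric `f` (`f(y,x) = f(x,y)`),
  under the coordinate swap ★ `C0fn_sw : C0((a₂,a₁),(b₂,b₁)) = C0(a,b)` (the diagonal `D₄` elements used by `ShellReduction`).
All four are read off `Happly_zero_prodState_re` (the `K = 0` Hamiltonian on the real product state is `6Π⁰ − ½Σ_e hop_e − ΔWΠ⁰`):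
`Π⁰`, `W`, `1_D` are invariant and the four hop triples are permuted among themselves.
Prover seat `hubbard-h0-rotor-p1` g27 (route lead); helper for stmt-HubbardSuperconductivity-23918 (`--supports`, helper class).
WHAT THIS IS NOT: nothing here proves superconductivity in the Hubbard model; symmetry bookkeeping of ONE row of ONE conditional
reduction.  Tree imports only; no new definitions; no sorry, no axioms.
-/

set_option linter.dupNamespace false
set_option autoImplicit false

noncomputable section

open scoped BigOperators

namespace Summit.HubbardSuperconductivity.HubbardSuperconductivity.Theorems.AnisotropyChord.Transfer.Fibre3

variable (L : ℕ) [NeZero L]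

namespace ShellRow

/-! ## §1 The two transpositions (`S₃`) -/

omit [NeZero L] in
/-- `Π⁰(b,a) = Π⁰(a,b)` for even `f`. [folklore] -/
theorem piR_swap {f : Tor L → ℝ} (heven : ∀ r : Tor L, f (-r) = f r) (c : Cfg L) :
    piR L f (c.2, c.1) = piR L f c := by
  unfold piR
  have h : c.1 - c.2 = -(c.2 - c.1) := by abel
  simp only [h, heven]
  ring

omit [NeZero L] in
/-- `Π⁰(−a, b−a) = Π⁰(a,b)` for even `f`. [folklore] -/
theorem piR_U12 {f : Tor L → ℝ} (heven : ∀ r : Tor L, f (-r) = f r) (c : Cfg L) :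
    piR L f (-c.1, c.2 - c.1) = piR L f c := by
  unfold piR
  have h : c.2 - c.1 - -c.1 = c.2 := by abel
  simp only [h, heven]
  ring

omit [NeZero L] in
/-- the hop triple is `2 ↔ 3` invariant (even `f`). [folklore] -/
theorem hopR_swap {f : Tor L → ℝ} (heven : ∀ r : Tor L, f (-r) = f r) (c : Cfg L) (e : Tor L) :
    hopR L f (c.2, c.1) e = hopR L f c e := by
  unfold hopR
  have h1 := piR_swap L heven (c.1, c.2 + e)
  have h2 := piR_swap L heven (c.1 + e, c.2)
  have h3 := piR_swap L heven (c.1 - e, c.2 - e)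
  simp only at h1 h2 h3 ⊢
  rw [h1, h2, h3]
  ring

omit [NeZero L] in
/-- the hop triple is `1 ↔ 2` invariant (even `f`). [folklore] -/
theorem hopR_U12 {f : Tor L → ℝ} (heven : ∀ r : Tor L, f (-r) = f r) (c : Cfg L) (e : Tor L) :
    hopR L f (-c.1, c.2 - c.1) e = hopR L f c e := by
  unfold hopR
  have h1 := piR_U12 L heven (c.1 - e, c.2 - e)
  have h2 := piR_U12 L heven (c.1, c.2 + e)
  have h3 := piR_U12 L heven (c.1 + e, c.2)
  have k1 : -(c.1 - e) = -c.1 + e := by abel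
  have k2 : c.2 - e - (c.1 - e) = c.2 - c.1 := by abel
  have k3 : c.2 + e - c.1 = c.2 - c.1 + e := by abel
  have k4 : -(c.1 + e) = -c.1 - e := by abel
  have k5 : c.2 - (c.1 + e) = c.2 - c.1 - e := by abel
  simp only [k1, k2, k3, k4, k5] at h1 h2 h3 ⊢
  rw [← h1, ← h2, ← h3]
  ring

/-- `Re (HΠ⁰)(b,a) = Re (HΠ⁰)(a,b)` at `K = 0` (even `f`). [folklore] -/
theorem happlyRe_swap (Δ : ℝ) {f : Tor L → ℝ} (heven : ∀ r : Tor L, f (-r) = f r) (c : Cfg L) :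
    (Happly L 0 Δ (prodState L f) (c.2, c.1)).re = (Happly L 0 Δ (prodState L f) c).re := by
  rw [Happly_zero_prodState_re, Happly_zero_prodState_re, Wcount_swap]
  simp only [hopR_swap L heven, piR_swap L heven]

/-- `Re (HΠ⁰)(−a,b−a) = Re (HΠ⁰)(a,b)` at `K = 0` (even `f`). [folklore] -/
theorem happlyRe_U12 (Δ : ℝ) {f : Tor L → ℝ} (heven : ∀ r : Tor L, f (-r) = f r) (c : Cfg L) :
    (Happly L 0 Δ (prodState L f) (-c.1, c.2 - c.1)).re = (Happly L 0 Δ (prodState L f) c).re := by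
  rw [Happly_zero_prodState_re, Happly_zero_prodState_re, Wcount_U12]
  simp only [hopR_U12 L heven, piR_U12 L heven]

/-- ★ `C0(b,a) = C0(a,b)` (even `f`). [folklore] -/
theorem C0fn_swap (Δ lam2 : ℝ) {f : Tor L → ℝ} (heven : ∀ r : Tor L, f (-r) = f r) (c : Cfg L) :
    C0fn L Δ lam2 f (c.2, c.1) = C0fn L Δ lam2 f c := by
  unfold C0fn
  rw [InD_swap, happlyRe_swap L Δ heven, piR_swap L heven]

/-- ★ `C0(−a, b−a) = C0(a,b)` (even `f`). [folklore] -/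
theorem C0fn_U12 (Δ lam2 : ℝ) {f : Tor L → ℝ} (heven : ∀ r : Tor L, f (-r) = f r) (c : Cfg L) :
    C0fn L Δ lam2 f (-c.1, c.2 - c.1) = C0fn L Δ lam2 f c := by
  unfold C0fn
  rw [InD_U12, happlyRe_U12 L Δ heven, piR_U12 L heven]

/-- ★ the composite relabelling `(a,b) ↦ (b − a, −a)` (= `2↔3 ∘ 1↔2`): `C0(b−a, −a) = C0(a,b)` (even `f`). [folklore] -/
theorem C0fn_rot (Δ lam2 : ℝ) {f : Tor L → ℝ} (heven : ∀ r : Tor L, f (-r) = f r) (c : Cfg L) :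
    C0fn L Δ lam2 f (c.2 - c.1, -c.1) = C0fn L Δ lam2 f c := by
  rw [← C0fn_U12 L Δ lam2 heven c, ← C0fn_swap L Δ lam2 heven (-c.1, c.2 - c.1)]

end ShellRow

/-- ★ **`C0PermInvariant L Δ` holds** (the two-magnon hypothesis is not even needed; evenness suffices). [folklore] -/
theorem c0PermInvariant_holds (Δ : ℝ) : C0PermInvariant L Δ := by
  intro lam2 f _ heven a b
  exact ⟨ShellRow.C0fn_swap L Δ lam2 heven (a, b), ShellRow.C0fn_U12 L Δ lam2 heven (a, b)⟩

namespace ShellRow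

/-! ## §2 Inversion and the coordinate swap (diagonal `D₄` elements) -/

omit [NeZero L] in
/-- `Π⁰(−c) = Π⁰(c)` (even `f`). [folklore] -/
theorem piR_neg {f : Tor L → ℝ} (heven : ∀ r : Tor L, f (-r) = f r) (c : Cfg L) :
    piR L f (-c) = piR L f c := by
  unfold piR
  have h : (-c).2 - (-c).1 = -(c.2 - c.1) := by simp only [Prod.fst_neg, Prod.snd_neg]; abel
  rw [h, Prod.fst_neg, Prod.snd_neg, heven, heven, heven]

omit [NeZero L] in
/-- the hop triple at `−c` in direction `e` is the hop triple at `c` in direction `−e` (even `f`). [folklore] -/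
theorem hopR_neg {f : Tor L → ℝ} (heven : ∀ r : Tor L, f (-r) = f r) (c : Cfg L) (e : Tor L) :
    hopR L f (-c) e = hopR L f c (-e) := by
  unfold hopR
  have h1 := piR_neg L heven (c.1 - e, c.2)
  have h2 := piR_neg L heven (c.1, c.2 - e)
  have h3 := piR_neg L heven (c.1 + e, c.2 + e)
  have k1 : (-((c.1 - e, c.2) : Cfg L)) = ((-c).1 + e, (-c).2) :=
    Prod.ext (by simp only [Prod.fst_neg, Prod.neg_mk]; abel) (by simp only [Prod.snd_neg, Prod.neg_mk])
  have k2 : (-((c.1, c.2 - e) : Cfg L)) = ((-c).1, (-c).2 + e) :=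
    Prod.ext (by simp only [Prod.fst_neg, Prod.neg_mk]) (by simp only [Prod.snd_neg, Prod.neg_mk]; abel)
  have k3 : (-((c.1 + e, c.2 + e) : Cfg L)) = ((-c).1 - e, (-c).2 - e) :=
    Prod.ext (by simp only [Prod.fst_neg, Prod.neg_mk]; abel) (by simp only [Prod.snd_neg, Prod.neg_mk]; abel)
  rw [k1] at h1
  rw [k2] at h2
  rw [k3] at h3
  rw [h1, h2, h3, sub_neg_eq_add, sub_neg_eq_add, ← sub_eq_add_neg, ← sub_eq_add_neg]

omit [NeZero L] in
/-- `W(−c) = W(c)`. [folklore] -/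
theorem Wcount_neg (c : Cfg L) : Wcount L (-c) = Wcount L c := by
  unfold Wcount
  have h : (-c).2 - (-c).1 = -(c.2 - c.1) := by simp only [Prod.fst_neg, Prod.snd_neg]; abel
  rw [h, Prod.fst_neg, Prod.snd_neg, IsNN_neg, IsNN_neg, IsNN_neg]

omit [NeZero L] in
/-- `1_D(−c) = 1_D(c)`. [folklore] -/
theorem InD_neg (c : Cfg L) : InD L (-c) = InD L c := by
  unfold InD
  simp only [Prod.fst_neg, Prod.snd_neg, neg_eq_zero, neg_inj]

/-- `Re (HΠ⁰)(−c) = Re (HΠ⁰)(c)` at `K = 0` (even `f`). [folklore] -/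
theorem happlyRe_neg (Δ : ℝ) {f : Tor L → ℝ} (heven : ∀ r : Tor L, f (-r) = f r) (c : Cfg L) :
    (Happly L 0 Δ (prodState L f) (-c)).re = (Happly L 0 Δ (prodState L f) c).re := by
  rw [Happly_zero_prodState_re, Happly_zero_prodState_re, Wcount_neg, piR_neg L heven]
  simp only [hopR_neg L heven, neg_neg]
  ring

/-- ★ `C0(−c) = C0(c)` (even `f`). [folklore] -/
theorem C0fn_neg (Δ lam2 : ℝ) {f : Tor L → ℝ} (heven : ∀ r : Tor L, f (-r) = f r) (c : Cfg L) :
    C0fn L Δ lam2 f (-c) = C0fn L Δ lam2 f c := by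
  unfold C0fn
  rw [InD_neg, happlyRe_neg L Δ heven, piR_neg L heven]

omit [NeZero L] in
/-- `Π⁰` is invariant under the simultaneous coordinate swap (swap-symmetric `f`). [folklore] -/
theorem piR_sw {f : Tor L → ℝ} (hsw : ∀ r : Tor L, f (r.2, r.1) = f r) (a b : Tor L) :
    piR L f ((a.2, a.1), (b.2, b.1)) = piR L f (a, b) := by
  unfold piR
  have h : ((b.2, b.1) : Tor L) - (a.2, a.1) = ((b - a).2, (b - a).1) := by
    simp only [Prod.mk_sub_mk, Prod.snd_sub, Prod.fst_sub]
  simp only [h, hsw]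

omit [NeZero L] in
/-- the hop triple at the swapped configuration in the swapped direction (swap-symmetric `f`). [folklore] -/
theorem hopR_sw {f : Tor L → ℝ} (hsw : ∀ r : Tor L, f (r.2, r.1) = f r) (a b e : Tor L) :
    hopR L f ((a.2, a.1), (b.2, b.1)) (e.2, e.1) = hopR L f (a, b) e := by
  unfold hopR
  have h1 := piR_sw L hsw (a + e) b
  have h2 := piR_sw L hsw a (b + e)
  have h3 := piR_sw L hsw (a - e) (b - e)
  simp only [Prod.fst_add, Prod.snd_add, Prod.fst_sub, Prod.snd_sub] at h1 h2 h3
  simp only [Prod.mk_add_mk, Prod.mk_sub_mk]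
  rw [h1, h2, h3]

omit [NeZero L] in
/-- `W` is invariant under the coordinate swap. [folklore] -/
theorem Wcount_sw (a b : Tor L) : Wcount L ((a.2, a.1), (b.2, b.1)) = Wcount L (a, b) := by
  unfold Wcount
  have h : ((b.2, b.1) : Tor L) - (a.2, a.1) = ((b - a).2, (b - a).1) := by
    simp only [Prod.mk_sub_mk, Prod.snd_sub, Prod.fst_sub]
  simp only [h, IsNN_swap]

omit [NeZero L] in
/-- `1_D` is invariant under the coordinate swap. [folklore] -/
theorem InD_sw (a b : Tor L) : InD L ((a.2, a.1), (b.2, b.1)) = InD L (a, b) := by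
  unfold InD
  have h1 : ((a.2, a.1) : Tor L) = 0 ↔ a = 0 := by
    constructor
    · intro h; exact Prod.ext (congrArg Prod.snd h) (congrArg Prod.fst h)
    · intro h; rw [h]; rfl
  have h2 : ((b.2, b.1) : Tor L) = 0 ↔ b = 0 := by
    constructor
    · intro h; exact Prod.ext (congrArg Prod.snd h) (congrArg Prod.fst h)
    · intro h; rw [h]; rfl
  have h3 : ((a.2, a.1) : Tor L) = (b.2, b.1) ↔ a = b := by
    constructor
    · intro h; exact Prod.ext (congrArg Prod.snd h) (congrArg Prod.fst h)
    · intro h; rw [h]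
  simp only [Bool.decide_congr h1, Bool.decide_congr h2, Bool.decide_congr h3]

/-- `Re (HΠ⁰)` is invariant under the coordinate swap at `K = 0` (swap-symmetric `f`). [folklore] -/
theorem happlyRe_sw (Δ : ℝ) {f : Tor L → ℝ} (hsw : ∀ r : Tor L, f (r.2, r.1) = f r) (a b : Tor L) :
    (Happly L 0 Δ (prodState L f) ((a.2, a.1), (b.2, b.1))).re = (Happly L 0 Δ (prodState L f) (a, b)).re := by
  rw [Happly_zero_prodState_re, Happly_zero_prodState_re, Wcount_sw, piR_sw L hsw]
  have x1 : ex L = (((ey L).2, (ey L).1) : Tor L) := rfl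
  have x2 : -ex L = (((-ey L).2, (-ey L).1) : Tor L) := by unfold ex ey; ext <;> simp
  have x3 : ey L = (((ex L).2, (ex L).1) : Tor L) := rfl
  have x4 : -ey L = (((-ex L).2, (-ex L).1) : Tor L) := by unfold ex ey; ext <;> simp
  have h1 : hopR L f ((a.2, a.1), (b.2, b.1)) (ex L) = hopR L f (a, b) (ey L) := by
    conv_lhs => rw [x1]
    exact hopR_sw L hsw a b (ey L)
  have h2 : hopR L f ((a.2, a.1), (b.2, b.1)) (-ex L) = hopR L f (a, b) (-ey L) := by
    conv_lhs => rw [x2]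
    exact hopR_sw L hsw a b (-ey L)
  have h3 : hopR L f ((a.2, a.1), (b.2, b.1)) (ey L) = hopR L f (a, b) (ex L) := by
    conv_lhs => rw [x3]
    exact hopR_sw L hsw a b (ex L)
  have h4 : hopR L f ((a.2, a.1), (b.2, b.1)) (-ey L) = hopR L f (a, b) (-ex L) := by
    conv_lhs => rw [x4]
    exact hopR_sw L hsw a b (-ex L)
  rw [h1, h2, h3, h4]
  ring

/-- ★ `C0` is invariant under the coordinate swap (swap-symmetric `f`). [folklore] -/
theorem C0fn_sw (Δ lam2 : ℝ) {f : Tor L → ℝ} (hsw : ∀ r : Tor L, f (r.2, r.1) = f r) (a b : Tor L) :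
    C0fn L Δ lam2 f ((a.2, a.1), (b.2, b.1)) = C0fn L Δ lam2 f (a, b) := by
  unfold C0fn
  rw [InD_sw, happlyRe_sw L Δ hsw, piR_sw L hsw]

omit [NeZero L] in
/-- `C0` vanishes on the hard core. [folklore] -/
theorem C0fn_D (Δ lam2 : ℝ) (f : Tor L → ℝ) (c : Cfg L) (hc : InD L c = true) : C0fn L Δ lam2 f c = 0 := by
  unfold C0fn
  rw [if_pos hc]

end ShellRow

end Summit.HubbardSuperconductivity.HubbardSuperconductivity.Theorems.AnisotropyChord.Transfer.Fibre3

end
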